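import Summits.Schanuel.Schanuel.Theorems.SoloInformedServedSet

/-!
# Distinct-root data: multiplicity-weighted cluster weights and crowding

Solo-informed Schanuel seat, session s191 (2026-08-31); sixth file (K5a) of the seat's kernel
plan for the MIXED Lemma AE₃ (`work/s188/MIXED-AE3-note.md` §2 (a)–(c), §6).  The three
value-level inputs of the mixed structured-roots theorem (next file), for a complex polynomial
`P ≠ 0` whose DISTINCT roots are listed injectively by `ρ : Fin D → ℂ` with multiplicities
`m`:

* `soloMR_exists_distinct_roots` — such a listing exists, with `m k = rootMultiplicity`,
  `1 ≤ m k`, every root listed, `∑ m = #roots`, and the factorisation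
  `∏_{roots} (z − r) = ∏_k (z − ρ k) ^ (m k)`;
* `soloMR_cluster_weight_ge` — `‖P(z)‖ ≤ e^{−V}`, `1 ≤ ‖lc P‖`, `∑ m ≤ N`, disc radius
  `e^{−c₁} ≤ r ≤ 1`: the weights `m_k log(1/‖ρ k − z‖)` of the roots in the disc about `z` sum
  to at least `V − c₁ N` (`soloCW_cluster_weight_ge` with multiplicities);
* `soloMR_card_crowded_mul_le` — Markov: the points `c` whose disc `‖· − (cξ + η)‖ < ‖ξ‖/2`
  carries total multiplicity `> t` number at most `(∑ m)/t` (`soloSS_card_crowded_mul_le` with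
  multiplicities).

## Why (seat bookkeeping)

Toy layer only (node `RoyAdditiveDirichletExponent`, [cite: Roy2010, Thm 1.1]); nothing here
bears on `Literature.Periods.SchanuelConjecture`; the seat's verdict (no path) is unchanged.
No novelty claimed; Mathlib + the seat files only; no definitions; no literature hypotheses;
standard axioms.
-/

namespace Summit.Schanuel.Schanuel.Theorems

open Polynomial Finset

section Listing

/-- **Distinct roots with multiplicities.**  See the file header. -/
theorem soloMR_exists_distinct_roots (P : ℂ[X]) (hP : P ≠ 0) :
    ∃ (D : ℕ) (ρ : Fin D → ℂ) (m : Fin D → ℕ), Function.Injective ρ ∧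
      (∀ k, m k = rootMultiplicity (ρ k) P) ∧ (∀ k, 1 ≤ m k) ∧
      (∀ z, P.IsRoot z → ∃ k, ρ k = z) ∧ (∑ k, m k = Multiset.card P.roots) ∧
      ∀ z : ℂ, (P.roots.map (fun a => z - a)).prod = ∏ k, (z - ρ k) ^ m k := by
  classical
  set Z : Finset ℂ := P.roots.toFinset with hZ
  set e := Z.equivFin with he
  refine ⟨Z.card, fun k => (e.symm k).1, fun k => P.roots.count (e.symm k).1,
    Subtype.val_injective.comp e.symm.injective, fun k => count_roots P, fun k => ?_,
    fun z hz => ?_, ?_, fun z => ?_⟩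
  · exact Multiset.one_le_count_iff_mem.mpr (Multiset.mem_toFinset.mp (e.symm k).2)
  · have hz' : z ∈ Z := Multiset.mem_toFinset.mpr ((mem_roots hP).mpr hz)
    exact ⟨e ⟨z, hz'⟩, by simp only [Equiv.symm_apply_apply]⟩
  · rw [← Multiset.toFinset_sum_count_eq P.roots, ← Finset.sum_coe_sort Z]
    exact (Fintype.sum_equiv e (fun x : {x // x ∈ Z} => P.roots.count x.1)
      (fun k => P.roots.count (e.symm k).1) (fun x => by rw [Equiv.symm_apply_apply])).symm
  · rw [Finset.prod_multiset_map_count, ← Finset.prod_coe_sort Z]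
    exact Fintype.prod_equiv e (fun x : {x // x ∈ Z} => (z - x.1) ^ P.roots.count x.1)
      (fun k => (z - (e.symm k).1) ^ P.roots.count (e.symm k).1)
      (fun x => by rw [Equiv.symm_apply_apply])

/-- `‖P(z)‖ = ‖lc P‖ ∏_k ‖z − ρ k‖ ^ (m k)` for a distinct-root listing. -/
theorem soloMR_norm_eval_eq {D : ℕ} (P : ℂ[X]) (ρ : Fin D → ℂ) (m : Fin D → ℕ)
    (hprod : ∀ z : ℂ, (P.roots.map (fun a => z - a)).prod = ∏ k, (z - ρ k) ^ m k) (z : ℂ) :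
    ‖P.eval z‖ = ‖P.leadingCoeff‖ * ∏ k, ‖z - ρ k‖ ^ m k := by
  rw [(IsAlgClosed.splits P).eval_eq_prod_roots z, hprod z, norm_mul, norm_prod]
  simp only [norm_pow]

end Listing

section Weights

variable {D : ℕ}

/-- **Multiplicity-weighted cluster weight.**  See the file header. -/
theorem soloMR_cluster_weight_ge {N : ℕ} (P : ℂ[X]) (hlc : 1 ≤ ‖P.leadingCoeff‖)
    (ρ : Fin D → ℂ) (m : Fin D → ℕ)
    (hprod : ∀ z : ℂ, (P.roots.map (fun a => z - a)).prod = ∏ k, (z - ρ k) ^ m k)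
    (hmN : ∑ k, m k ≤ N) (z : ℂ) {r c₁ V : ℝ} (hr1 : r ≤ 1) (hc : Real.exp (-c₁) ≤ r)
    (hsmall : ‖P.eval z‖ ≤ Real.exp (-V)) (hz : ∀ k, ρ k ≠ z) :
    V - c₁ * N ≤ ∑ k ∈ univ.filter (fun k => ‖ρ k - z‖ < r),
      (m k : ℝ) * Real.log (1 / ‖ρ k - z‖) := by
  have hr0 : 0 < r := (Real.exp_pos _).trans_le hc
  have hdpos : ∀ k, 0 < ‖z - ρ k‖ := fun k => norm_pos_iff.mpr (sub_ne_zero.mpr (hz k).symm)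
  set A := univ.filter (fun k => ‖ρ k - z‖ < r) with hA
  set B := univ.filter (fun k => ¬ ‖ρ k - z‖ < r) with hB
  have hsplit : ∏ k, ‖z - ρ k‖ ^ m k = (∏ k ∈ A, ‖z - ρ k‖ ^ m k) * ∏ k ∈ B, ‖z - ρ k‖ ^ m k :=
    (Finset.prod_filter_mul_prod_filter_not univ _ _).symm
  have hc₁0 : 0 ≤ c₁ := by
    have h := Real.exp_le_one_iff.mp (hc.trans hr1)
    linarith
  have hout : Real.exp (-(c₁ * N)) ≤ ∏ k ∈ B, ‖z - ρ k‖ ^ m k := by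
    have hBN : ∑ k ∈ B, m k ≤ N :=
      (Finset.sum_le_sum_of_subset_of_nonneg (Finset.subset_univ B)
        (fun _ _ _ => Nat.zero_le _)).trans hmN
    calc Real.exp (-(c₁ * N)) = Real.exp (-c₁) ^ N := by
          rw [← Real.exp_nat_mul]; ring_nf
      _ ≤ r ^ N := pow_le_pow_left₀ (Real.exp_pos _).le hc N
      _ ≤ r ^ (∑ k ∈ B, m k) := pow_le_pow_of_le_one hr0.le hr1 hBN
      _ = ∏ k ∈ B, r ^ m k := (Finset.prod_pow_eq_pow_sum B m r).symm
      _ ≤ ∏ k ∈ B, ‖z - ρ k‖ ^ m k := by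
          refine Finset.prod_le_prod (fun _ _ => pow_nonneg hr0.le _) (fun k hk => ?_)
          refine pow_le_pow_left₀ hr0.le ?_ _
          rw [norm_sub_rev]
          exact not_lt.mp (Finset.mem_filter.mp hk).2
  have hApos : 0 < ∏ k ∈ A, ‖z - ρ k‖ ^ m k := Finset.prod_pos fun k _ => pow_pos (hdpos k) _
  have hprod_le : ∏ k, ‖z - ρ k‖ ^ m k ≤ Real.exp (-V) := by
    have h : ∏ k, ‖z - ρ k‖ ^ m k ≤ ‖P.eval z‖ := by
      rw [soloMR_norm_eval_eq P ρ m hprod z]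
      exact le_mul_of_one_le_left
        (Finset.prod_nonneg fun k _ => pow_nonneg (norm_nonneg _) _) hlc
    exact h.trans hsmall
  have hkey : (∏ k ∈ A, ‖z - ρ k‖ ^ m k) * Real.exp (-(c₁ * N)) ≤ Real.exp (-V) :=
    ((mul_le_mul_of_nonneg_left hout hApos.le).trans hsplit.symm.le).trans hprod_le
  have hkey' : ∏ k ∈ A, ‖z - ρ k‖ ^ m k ≤ Real.exp (-V + c₁ * N) := by
    rw [show -V + c₁ * N = -V - (-(c₁ * N)) by ring, Real.exp_sub,
      le_div_iff₀ (Real.exp_pos _)]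
    exact hkey
  have hlog := Real.log_le_log hApos hkey'
  rw [Real.log_exp, Real.log_prod (fun k _ => (pow_pos (hdpos k) _).ne')] at hlog
  have hsum : ∑ k ∈ A, (m k : ℝ) * Real.log (1 / ‖ρ k - z‖) =
      -∑ k ∈ A, Real.log (‖z - ρ k‖ ^ m k) := by
    rw [← Finset.sum_neg_distrib]
    refine Finset.sum_congr rfl (fun k _ => ?_)
    rw [Real.log_pow, one_div, Real.log_inv, norm_sub_rev, mul_neg]
  rw [hsum]
  linarith

/-- Disjoint discs: the total multiplicity over a union of discs `‖· − (cξ + η)‖ < ‖ξ‖/2`,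
`c ∈ C`, is at most `∑ m`. -/
theorem soloMR_sum_sum_filter_le (ρ : Fin D → ℂ) (m : Fin D → ℕ) (ξ η : ℂ) (C : Finset ℕ) :
    ∑ c ∈ C, ∑ k ∈ univ.filter (fun k => ‖ρ k - (c * ξ + η)‖ < ‖ξ‖ / 2), m k ≤ ∑ k, m k := by
  rw [← Finset.sum_biUnion (fun c _ c' _ hcc => soloSS_filter_disjoint ρ ξ η hcc)]
  exact Finset.sum_le_sum_of_subset_of_nonneg (Finset.subset_univ _) (fun _ _ _ => Nat.zero_le _)

/-- **Markov for multiplicity-crowded points.**  See the file header. -/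
theorem soloMR_card_crowded_mul_le (ρ : Fin D → ℂ) (m : Fin D → ℕ) (ξ η : ℂ) (C : Finset ℕ)
    (t : ℝ) :
    (#(C.filter (fun c : ℕ => t <
        ((∑ k ∈ univ.filter (fun k => ‖ρ k - (c * ξ + η)‖ < ‖ξ‖ / 2), m k : ℕ) : ℝ))) : ℝ) * t
      ≤ ((∑ k, m k : ℕ) : ℝ) := by
  set w : ℕ → ℕ := fun c => ∑ k ∈ univ.filter (fun k => ‖ρ k - (c * ξ + η)‖ < ‖ξ‖ / 2), m k
    with hw
  calc (#(C.filter (fun c => t < (w c : ℝ))) : ℝ) * t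
      = ∑ _c ∈ C.filter (fun c => t < (w c : ℝ)), t := by
        rw [Finset.sum_const, nsmul_eq_mul]
    _ ≤ ∑ c ∈ C.filter (fun c => t < (w c : ℝ)), (w c : ℝ) :=
        Finset.sum_le_sum (fun c hc => (Finset.mem_filter.mp hc).2.le)
    _ = ((∑ c ∈ C.filter (fun c => t < (w c : ℝ)), w c : ℕ) : ℝ) := by push_cast; rfl
    _ ≤ ((∑ k, m k : ℕ) : ℝ) := by
        exact_mod_cast soloMR_sum_sum_filter_le ρ m ξ η (C.filter (fun c => t < (w c : ℝ)))

end Weights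

end Summit.Schanuel.Schanuel.Theorems
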